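import Summits.QuantumAdvantage.QuantumAdvantage.Theorems.MobiusLadderLiouvilleNotPPolyOneTimePad
import Summits.QuantumAdvantage.QuantumAdvantage.Theorems.MobiusLadderLiouvilleOrthogonalTC0StubXor
import Summits.QuantumAdvantage.QuantumAdvantage.Theorems.MobiusLadderLiouvilleOrthogonalTC0TransferCell
import Literature.Computability.Complexity.CircuitClassesProofs
import HarnessLib

/-!
# Crux `MobiusLadder.LiouvilleNotPPoly` (stmt-QuantumAdvantage-1389), line `SketchIdeator4`, stub `stub_selfAmplification`

T2c of the line: Yao's XOR lemma for `λ` on the Kalai product ensemble, ASSEMBLED from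

* T2a (hypothesis 1): restricting a product-reading `B₂`-circuit `C` on `k·n` inputs to one factor
  (`y ↦ C(low k·n digits of (ofBits y)·M)`) costs `s ↦ s + (k n (148 k n + 1) + 3)` gates;
* T2b (hypothesis 2): Impagliazzo's hard-core measure `M` on the instances `U = [2^{n-1}, 2^n)` of
  density `δ = (∑_U M)/2^{n-1} ∈ [n^{-c}, 2 n^{-c}]`, against which every `B₂`-circuit of size
  `≤ q(n)` has `λ`-correlation `≤ ε₁ ∑_U M`;

through the tree's ABSTRACT multiplicative XOR lemma with hard-core measures
`LiouvilleOrthogonalTC0.stub_xor` (crux 1393):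
`|∑_{t ∈ U^k} (∏ᵢ λ(tᵢ)) g(t)| ≤ (k γ + (1-δ)^k) (#U)^k`.

Proof. Since `λ` is completely multiplicative, `λ(∏ᵢ tᵢ) = ∏ᵢ λ(tᵢ)` (the tree's
`LiouvilleOrthogonalTC0.Transfer.liouville_finset_prod`, crux 1393), the
numerator of `prodCorr n k C` is the sum of the XOR lemma for the test `g(t) = sgn C(bits (∏ᵢ tᵢ))`
(`sum_box_eq` reindexes `v ↦ 2^{n-1} + v` onto the box `U^k`). Along coordinate `i` with context `t`
the test is `u ↦ sgn C(bits (u · ∏_{j ≠ i} t_j))` (`Finset.prod_update_of_mem`), a circuit of T2a of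
size `≤ p(k n · n) + k n·n (148 k n·n + 1) + 3 ≤ q(n)` for the polynomial
`q = p ∘ r + r (148 r + 1) + 3`, `r = (X^d + d) X ≥ k(n)·n` (`kk_le`, `TM2Iter.eval_mono`), so T2b
bounds its `M`-correlation by `ε₁ ∑_U M = γ · #U` with `γ = ε₁ δ` (`abs_prodCorr_le`). Numbers
(`numeric_bound`): with `k(n) = T n^c + 1`, `T = ⌈2/ε⌉`, `ε₁ = ε/(4T+4)`:
`k γ = ε₁ (T n^c δ + δ) ≤ ε₁ (2T + 2) = ε/2` and `(1-δ)^k ≤ e^{-k δ} ≤ e^{-T} ≤ 1/(T+1) ≤ ε/2`.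

Sources: R. Impagliazzo, *Hard-core distributions for somewhat hard problems*, FOCS 1995, Thm. 2
and §4; O. Goldreich, N. Nisan, A. Wigderson, *On Yao's XOR-Lemma*, ECCC TR95-050 (1995),
Lemma 13; S. Arora, B. Barak, *Computational Complexity* (2009), Thm. 19.2.
-/

set_option linter.dupNamespace false -- D-0017: single-problem summit ⇒ `QuantumAdvantage.QuantumAdvantage` by design

noncomputable section

namespace Summit.QuantumAdvantage.QuantumAdvantage.Theorems.LiouvilleNotPPoly.OneTimePad

open Literature.Computability.Complexity
open Literature.Probability.RandomGraphs.LowDegree (sgn sgn_true sgn_false)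
open _root_.Computability Filter Finset Polynomial
open Summit.QuantumAdvantage.QuantumAdvantage.Theorems.MobiusLadder
open Summit.QuantumAdvantage.QuantumAdvantage.Theorems.LiouvilleOrthogonalTC0 (bits ofBits lamBit)

namespace SelfAmplification

/-! ### Reindexing the Kalai box -/

/-- For `n ≥ 1`, the tuples `v : Fin k → Fin (2^{n-1})` parametrise the box `[2^{n-1}, 2^n)^k` by
`tᵢ = 2^{n-1} + vᵢ`: a sum over the former is a sum over `Fintype.piFinset` of the latter. [folklore] -/
theorem sum_box_eq {n : ℕ} (k : ℕ) (hn : 1 ≤ n) (F : (Fin k → ℕ) → ℝ) :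
    ∑ v : Fin k → Fin (2 ^ (n - 1)), F (fun i => 2 ^ (n - 1) + (v i : ℕ)) =
      ∑ t ∈ Fintype.piFinset (fun _ : Fin k => Finset.Ico (2 ^ (n - 1)) (2 ^ n)), F t := by
  have h2n : 2 ^ n = 2 ^ (n - 1) + 2 ^ (n - 1) := by
    rw [← two_mul, ← pow_succ']; congr 1; omega
  rw [h2n]
  generalize ha : 2 ^ (n - 1) = a
  have ha0 : 0 < a := ha ▸ Nat.two_pow_pos _
  refine Finset.sum_nbij' (fun v i => a + (v i : ℕ))
    (fun t i => ⟨(t i - a) % a, Nat.mod_lt _ ha0⟩) ?_ ?_ ?_ ?_ ?_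
  · intro v _
    rw [Fintype.mem_piFinset]
    intro i
    rw [Finset.mem_Ico]
    exact ⟨Nat.le_add_right _ _, Nat.add_lt_add_left (v i).isLt _⟩
  · intro t _
    exact Finset.mem_univ _
  · intro v _
    funext i
    apply Fin.ext
    simp only [Nat.add_sub_cancel_left]
    exact Nat.mod_eq_of_lt (v i).isLt
  · intro t ht
    rw [Fintype.mem_piFinset] at ht
    funext i
    have hi := Finset.mem_Ico.1 (ht i)
    simp only
    rw [Nat.mod_eq_of_lt (by omega)]
    omega
  · intro v _
    rfl

/-! ### The growth parameter and the size polynomial -/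

/-- The number of factors `k(n) = T n^c + 1` is polynomially bounded in the tree's normal form
`k(n) ≤ n^d + d`, `d = c + T + 1` (for `n ≥ 2` use `T < 2^T ≤ n^T`). [folklore] -/
theorem kk_le (T c n : ℕ) : T * n ^ c + 1 ≤ n ^ (c + T + 1) + (c + T + 1) := by
  rcases Nat.lt_or_ge n 2 with hn | hn
  · have hc : n ^ c ≤ 1 := pow_le_one₀ (Nat.zero_le _) (by omega)
    have hT : T * n ^ c ≤ T := by simpa using Nat.mul_le_mul_left T hc
    omega
  · have hT : T ≤ n ^ T := Nat.lt_two_pow_self.le.trans (Nat.pow_le_pow_left hn T)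
    have h1 : T * n ^ c ≤ n ^ T * n ^ c := Nat.mul_le_mul_right _ hT
    have h2 : n ^ T * n ^ c ≤ n ^ T * n ^ c * n := Nat.le_mul_of_pos_right _ (by omega)
    have h3 : n ^ (c + T + 1) = n ^ T * n ^ c * n := by ring
    omega

/-! ### The combinatorial core: the XOR lemma on the Kalai box -/

/-- **The XOR lemma on the Kalai product ensemble.** If `M : U → [0,1]` (`U = [2^{n-1}, 2^n)`,
`n ≥ 1`) is such that for EVERY constant `P` the one-factor test `u ↦ sgn C(bits (u·P))` has
`M`-weighted `λ`-correlation `≤ ε₁ ∑_U M` on `U`, then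
`|prodCorr n k C| ≤ k ε₁ δ + (1 - δ)^k`, `δ = (∑_U M)/2^{n-1}`: the abstract multiplicative XOR
lemma `LiouvilleOrthogonalTC0.stub_xor` for `Uᵢ = U`, `Mᵢ = M`, `lam = λ` (completely
multiplicative, `Transfer.liouville_finset_prod`), `g(t) = sgn C(bits (∏ᵢ tᵢ))`, `γ = ε₁ δ`; along
coordinate `i`
the test is the one-factor test with `P = ∏_{j ≠ i} t_j` (`Finset.prod_update_of_mem`).
[cite: Impagliazzo1995, Thm. 2] -/
theorem abs_prodCorr_le {n k : ℕ} (hn : 1 ≤ n) (M : ℕ → ℝ) (hM : ∀ u, 0 ≤ M u ∧ M u ≤ 1)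
    {ε₁ : ℝ} (hε₁ : 0 ≤ ε₁) (C : Circuit (Fin (k * n)))
    (hcore : ∀ P : ℕ, |∑ u ∈ Finset.Ico (2 ^ (n - 1)) (2 ^ n),
        M u * ((ArithmeticFunction.liouville u : ℤ) : ℝ) * sgn (C.eval (bits (k * n) (u * P)))| ≤
      ε₁ * ∑ u ∈ Finset.Ico (2 ^ (n - 1)) (2 ^ n), M u) :
    |prodCorr n k C| ≤
      k * (ε₁ * (∑ u ∈ Finset.Ico (2 ^ (n - 1)) (2 ^ n), M u) / (2 : ℝ) ^ (n - 1)) +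
        (1 - (∑ u ∈ Finset.Ico (2 ^ (n - 1)) (2 ^ n), M u) / (2 : ℝ) ^ (n - 1)) ^ k := by
  set U : Finset ℕ := Finset.Ico (2 ^ (n - 1)) (2 ^ n) with hU
  set S : ℝ := ∑ u ∈ U, M u with hS
  set A : ℝ := (2 : ℝ) ^ (n - 1) with hA
  have hApos : 0 < A := by positivity
  have h2n : 2 ^ n = 2 ^ (n - 1) + 2 ^ (n - 1) := by
    rw [← two_mul, ← pow_succ']; congr 1; omega
  have hcardU : #U = 2 ^ (n - 1) := by rw [hU, Nat.card_Ico, h2n, Nat.add_sub_cancel]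
  have hcardR : (#U : ℝ) = A := by rw [hcardU, hA]; push_cast; rfl
  have hS0 : 0 ≤ S := Finset.sum_nonneg fun u _ => (hM u).1
  have hγ : 0 ≤ ε₁ * S / A := div_nonneg (mul_nonneg hε₁ hS0) hApos.le
  -- the hard-core hypothesis along every coordinate of the box
  have hc : ∀ (i : Fin k) (t : Fin k → ℕ),
      |∑ u ∈ U, M u * ((ArithmeticFunction.liouville u : ℤ) : ℝ) *
          sgn (C.eval (bits (k * n) (∏ j, Function.update t i u j)))| ≤ ε₁ * S / A * #U := by
    intro i t
    simp_rw [Finset.prod_update_of_mem (Finset.mem_univ i) t]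
    rw [hcardR, div_mul_cancel₀ _ hApos.ne']
    exact hcore _
  -- the abstract multiplicative XOR lemma
  have hxor := LiouvilleOrthogonalTC0.stub_xor k (fun _ => U) (fun _ => M)
    (fun u => ((ArithmeticFunction.liouville u : ℤ) : ℝ))
    (fun t => sgn (C.eval (bits (k * n) (∏ i, t i)))) (ε₁ * S / A)
    hγ (fun _ u => hM u) abs_cast_liouville_le_one
    (fun t => LiouvilleOrthogonalTC0.Transfer.abs_sgn_le_one _) hc
  have hxor' : |∑ t ∈ Fintype.piFinset (fun _ : Fin k => U),
      (∏ i, ((ArithmeticFunction.liouville (t i) : ℤ) : ℝ)) *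
        sgn (C.eval (bits (k * n) (∏ i, t i)))| ≤ (k * (ε₁ * S / A) + (1 - S / A) ^ k) * A ^ k := by
    have h := hxor
    simp only [Fin.prod_const, hcardR] at h
    exact h
  -- the numerator of `prodCorr` is the sum of the XOR lemma
  have hnum : (∑ v : Fin k → Fin (2 ^ (n - 1)),
      ((ArithmeticFunction.liouville (∏ i, (2 ^ (n - 1) + (v i : ℕ))) : ℤ) : ℝ) *
        sgn (C.eval (bits (k * n) (∏ i, (2 ^ (n - 1) + (v i : ℕ)))))) =
      ∑ t ∈ Fintype.piFinset (fun _ : Fin k => U),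
        (∏ i, ((ArithmeticFunction.liouville (t i) : ℤ) : ℝ)) *
          sgn (C.eval (bits (k * n) (∏ i, t i))) := by
    refine (sum_box_eq k hn (fun t => ((ArithmeticFunction.liouville (∏ i, t i) : ℤ) : ℝ) *
      sgn (C.eval (bits (k * n) (∏ i, t i))))).trans ?_
    refine Finset.sum_congr rfl fun t _ => ?_
    rw [LiouvilleOrthogonalTC0.Transfer.liouville_finset_prod, Int.cast_prod]
  have hprodCorr : prodCorr n k C =
      (∑ t ∈ Fintype.piFinset (fun _ : Fin k => U),
        (∏ i, ((ArithmeticFunction.liouville (t i) : ℤ) : ℝ)) *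
          sgn (C.eval (bits (k * n) (∏ i, t i)))) / A ^ k := by
    rw [prodCorr, hnum]
  rw [hprodCorr, abs_div, abs_of_pos (pow_pos hApos k), div_le_iff₀ (pow_pos hApos k)]
  exact hxor'

/-! ### The numbers -/

/-- **The numerical bookkeeping.** With `N = n^c ≥ 1`, `δ = S/A ∈ [1/N, 2/N]`, `δ ≤ 1`,
`k = T N + 1`, `ε₁ = ε/(4T+4)` and `T ≥ 2/ε`:
`k ε₁ δ = ε₁ (T·Nδ + δ) ≤ ε₁ (2T+2) = ε/2` and
`(1-δ)^k ≤ e^{-kδ} ≤ e^{-T} ≤ 1/(T+1) ≤ ε/2` (`Real.one_sub_le_exp_neg`, `Real.add_one_le_exp`).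
[folklore] -/
theorem numeric_bound {T c n : ℕ} (hn : 1 ≤ n) {ε : ℝ} (hε : 0 < ε) (hT : 2 / ε ≤ (T : ℝ))
    {S A : ℝ} (hA : 0 < A) (hlo : A ≤ (n : ℝ) ^ c * S) (hhi : (n : ℝ) ^ c * S ≤ 2 * A)
    (hSA : S ≤ A) :
    ((T * n ^ c + 1 : ℕ) : ℝ) * (ε / (4 * T + 4) * S / A) + (1 - S / A) ^ (T * n ^ c + 1) ≤ ε := by
  set N : ℝ := (n : ℝ) ^ c with hN
  set δ : ℝ := S / A with hδ
  have hNδlo : 1 ≤ N * δ := by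
    rw [hδ, mul_div_assoc', le_div_iff₀ hA, one_mul]; exact hlo
  have hNδhi : N * δ ≤ 2 := by
    rw [hδ, mul_div_assoc', div_le_iff₀ hA]; exact hhi
  have hδ1 : δ ≤ 1 := by rwa [hδ, div_le_one hA]
  have hN0 : 0 ≤ N := by positivity
  have hδ0 : 0 ≤ δ := by
    rcases le_or_gt 0 δ with h | h
    · exact h
    · have : N * δ ≤ 0 := mul_nonpos_of_nonneg_of_nonpos hN0 h.le
      linarith
  have hT0 : (0 : ℝ) ≤ T := Nat.cast_nonneg T
  -- first term
  have h1 : ((T * n ^ c + 1 : ℕ) : ℝ) * (ε / (4 * T + 4) * S / A) ≤ ε / 2 := by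
    have hkey : ((T : ℝ) * N + 1) * δ ≤ 2 * T + 2 := by
      have := mul_le_mul_of_nonneg_left hNδhi hT0
      linarith
    have hE : 0 ≤ ε / (4 * T + 4) := by positivity
    calc ((T * n ^ c + 1 : ℕ) : ℝ) * (ε / (4 * T + 4) * S / A)
        = ε / (4 * T + 4) * (((T : ℝ) * N + 1) * δ) := by
          push_cast
          rw [hδ, hN]
          ring
      _ ≤ ε / (4 * T + 4) * (2 * T + 2) := mul_le_mul_of_nonneg_left hkey hE
      _ = ε / 2 := by
          field_simp
          ring
  -- second term
  have h2 : (1 - δ) ^ (T * n ^ c + 1) ≤ ε / 2 := by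
    have hstep : (1 - δ) ^ (T * n ^ c + 1) ≤ Real.exp (-δ) ^ (T * n ^ c + 1) :=
      pow_le_pow_left₀ (by linarith) (Real.one_sub_le_exp_neg δ) _
    rw [← Real.exp_nat_mul] at hstep
    have hexp : Real.exp (((T * n ^ c + 1 : ℕ) : ℝ) * -δ) ≤ Real.exp (-(T : ℝ)) := by
      rw [Real.exp_le_exp]
      push_cast
      rw [← hN]
      have := mul_le_mul_of_nonneg_left hNδlo hT0
      linarith
    have h2e : 2 / ε ≤ Real.exp (T : ℝ) := by
      have := Real.add_one_le_exp (T : ℝ)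
      linarith
    have hexpT : Real.exp (-(T : ℝ)) ≤ ε / 2 := by
      rw [Real.exp_neg, inv_eq_one_div]
      calc 1 / Real.exp (T : ℝ) ≤ 1 / (2 / ε) := one_div_le_one_div_of_le (by positivity) h2e
        _ = ε / 2 := one_div_div 2 ε
    exact hstep.trans (hexp.trans hexpT)
  linarith

/-- The total mass of a `[0,1]`-valued measure on `U = [2^{n-1}, 2^n)` is at most `#U = 2^{n-1}`
(`n ≥ 1`). [folklore] -/
theorem sum_Ico_le {n : ℕ} (hn : 1 ≤ n) (M : ℕ → ℝ) (hM : ∀ u, 0 ≤ M u ∧ M u ≤ 1) :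
    ∑ u ∈ Finset.Ico (2 ^ (n - 1)) (2 ^ n), M u ≤ (2 : ℝ) ^ (n - 1) := by
  have h2n : 2 ^ n = 2 ^ (n - 1) + 2 ^ (n - 1) := by
    rw [← two_mul, ← pow_succ']; congr 1; omega
  have hcardU : #(Finset.Ico (2 ^ (n - 1)) (2 ^ n)) = 2 ^ (n - 1) := by
    rw [Nat.card_Ico, h2n, Nat.add_sub_cancel]
  calc ∑ u ∈ Finset.Ico (2 ^ (n - 1)) (2 ^ n), M u
      ≤ ∑ u ∈ Finset.Ico (2 ^ (n - 1)) (2 ^ n), (1 : ℝ) := Finset.sum_le_sum fun u _ => (hM u).2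
    _ = (2 : ℝ) ^ (n - 1) := by
        rw [Finset.sum_const, nsmul_eq_mul, mul_one, hcardU]
        push_cast
        rfl

end SelfAmplification

open SelfAmplification

/-- **T2c · `stub_selfAmplification` — XOR self-amplification on Kalai products, given T2a and
T2b.** Because `λ(∏ Nᵢ) = ∏ λ(Nᵢ)`, the abstract multiplicative XOR lemma with hard-core measures
(`LiouvilleOrthogonalTC0.stub_xor`, crux 1393: `|∑_t (∏ᵢ λ(tᵢ)) g(t)| ≤ (k γ + ∏ᵢ (1-δᵢ)) ∏ᵢ #Uᵢ`)
applies to `Uᵢ = [2^{n-1}, 2^n)`, `Mᵢ = M` (T2b, density `δ ∈ [n^{-c}, 2n^{-c}]`, `γ = ε₁ δ`) and the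
test `g(t) = sgn C(bits (∏ᵢ tᵢ))`: along coordinate `i` with context `t` the test is the circuit
`u ↦ C(bits (u · ∏_{j≠i} t_j))` of T2a (size `≤ q(n)`, `q = p ∘ r + r (148 r + 1) + 3`,
`r = (X^d + d) X ≥ k(n)·n`), so T2b bounds its `M`-correlation by `ε₁ ∑ M = γ #U`
(`SelfAmplification.abs_prodCorr_le`). With `k(n) = T n^c + 1`, `T = ⌈2/ε⌉`, `ε₁ = ε/(4T+4)`:
`k γ ≤ ε₁ (2T+2) ≤ ε/2` and `(1-δ)^k ≤ e^{-T} ≤ ε/2` (`SelfAmplification.numeric_bound`), so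
`|prodCorr n (k n) C| ≤ ε`.
[cite: Impagliazzo1995, Thm. 2 and §4] [cite: GoldreichNisanWigderson1995, Lemma 13] -/
theorem stub_selfAmplification :
    (∀ n k s M : ℕ, 1 ≤ k → ∀ C : Circuit (Fin (k * n)), C.IsOver B2 → C.size ≤ s →
      CktSize B2 (fun (y : Fin n → Bool) (_ : Unit) => C.eval (bits (k * n) (ofBits y * M)))
        (s + (k * n * (148 * (k * n) + 1) + 3))) →
    (∀ c : ℕ, MildAvgHard c → ∀ q : Polynomial ℕ, ∀ ε₁ : ℝ, 0 < ε₁ →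
      ∀ᶠ n : ℕ in atTop, ∃ M : ℕ → ℝ, (∀ u, 0 ≤ M u ∧ M u ≤ 1) ∧
        (2 : ℝ) ^ (n - 1) ≤ (n : ℝ) ^ c * ∑ u ∈ Finset.Ico (2 ^ (n - 1)) (2 ^ n), M u ∧
        (n : ℝ) ^ c * ∑ u ∈ Finset.Ico (2 ^ (n - 1)) (2 ^ n), M u ≤ 2 * (2 : ℝ) ^ (n - 1) ∧
        ∀ D : Circuit (Fin n), D.IsOver B2 → D.size ≤ q.eval n →
          |∑ u ∈ Finset.Ico (2 ^ (n - 1)) (2 ^ n),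
              M u * ((ArithmeticFunction.liouville u : ℤ) : ℝ) * sgn (D.eval (bits n u))| ≤
            ε₁ * ∑ u ∈ Finset.Ico (2 ^ (n - 1)) (2 ^ n), M u) →
    ∀ c : ℕ, MildAvgHard c → ∀ p : Polynomial ℕ, ∀ ε : ℝ, 0 < ε →
      ∃ k : ℕ → ℕ, (∃ d : ℕ, ∀ n, k n ≤ n ^ d + d) ∧ (∀ n, 1 ≤ k n) ∧
        ∀ᶠ n : ℕ in atTop, ∀ C : Circuit (Fin (k n * n)), C.IsOver B2 →
          C.size ≤ p.eval (k n * n) → |prodCorr n (k n) C| ≤ ε := by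
  intro h1 h2 c H p ε hε
  obtain ⟨T, hT⟩ : ∃ T : ℕ, 2 / ε ≤ (T : ℝ) := ⟨⌈2 / ε⌉₊, Nat.le_ceil _⟩
  refine ⟨fun n => T * n ^ c + 1, ⟨c + T + 1, fun n => kk_le T c n⟩, fun n => Nat.succ_pos _, ?_⟩
  -- the size polynomial `q = p ∘ r + r (148 r + 1) + 3`, `r = (X^d + d) X`, and `ε₁ = ε/(4T+4)`
  set d : ℕ := c + T + 1 with hd
  set r : ℕ[X] := (X ^ d + Polynomial.C d) * X with hr
  set q : ℕ[X] := p.comp r + r * (Polynomial.C 148 * r + 1) + 3 with hq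
  have hε₁ : 0 < ε / (4 * T + 4) := by positivity
  filter_upwards [h2 c H q (ε / (4 * T + 4)) hε₁, eventually_ge_atTop 1] with n hn hn1 C hC hsize
  obtain ⟨M, hM01, hlo, hhi, hcorr⟩ := hn
  -- size bookkeeping: `p(k n · n) + k n·n (148 k n·n + 1) + 3 ≤ q(n)`
  have hr_eval : r.eval n = (n ^ d + d) * n := by simp [hr]
  have hq_eval : q.eval n = p.eval (r.eval n) + r.eval n * (148 * r.eval n + 1) + 3 := by
    simp [hq]
  have hkn : (T * n ^ c + 1) * n ≤ r.eval n := by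
    rw [hr_eval]; exact Nat.mul_le_mul_right _ (kk_le T c n)
  have hbound : p.eval ((T * n ^ c + 1) * n) +
      ((T * n ^ c + 1) * n * (148 * ((T * n ^ c + 1) * n) + 1) + 3) ≤ q.eval n := by
    rw [hq_eval]
    have h1' := TM2Iter.eval_mono p hkn
    have h2' : (T * n ^ c + 1) * n * (148 * ((T * n ^ c + 1) * n) + 1) ≤
        r.eval n * (148 * r.eval n + 1) := Nat.mul_le_mul hkn (by omega)
    omega
  -- the one-factor tests are circuits of size `≤ q(n)` (T2a), so T2b bounds their correlation
  have hcoreP : ∀ P : ℕ, |∑ u ∈ Finset.Ico (2 ^ (n - 1)) (2 ^ n),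
      M u * ((ArithmeticFunction.liouville u : ℤ) : ℝ) *
        sgn (C.eval (bits ((T * n ^ c + 1) * n) (u * P)))| ≤
      ε / (4 * T + 4) * ∑ u ∈ Finset.Ico (2 ^ (n - 1)) (2 ^ n), M u := by
    intro P
    obtain ⟨D, hD, hDsize, hDeval⟩ :=
      ((h1 n (T * n ^ c + 1) (p.eval ((T * n ^ c + 1) * n)) P (Nat.succ_pos _) C hC hsize).of_le
        hbound).toCircuit
    have hDeval' : ∀ x : Fin n → Bool,
        D.eval x = C.eval (bits ((T * n ^ c + 1) * n) (ofBits x * P)) := hDeval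
    have h := hcorr D hD hDsize
    have heq : ∑ u ∈ Finset.Ico (2 ^ (n - 1)) (2 ^ n),
        M u * ((ArithmeticFunction.liouville u : ℤ) : ℝ) * sgn (D.eval (bits n u)) =
        ∑ u ∈ Finset.Ico (2 ^ (n - 1)) (2 ^ n), M u * ((ArithmeticFunction.liouville u : ℤ) : ℝ) *
          sgn (C.eval (bits ((T * n ^ c + 1) * n) (u * P))) := by
      refine Finset.sum_congr rfl fun u hu => ?_
      rw [hDeval', LiouvilleOrthogonalTC0.ofBits_bits, Nat.mod_eq_of_lt (Finset.mem_Ico.1 hu).2]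
    rwa [heq] at h
  -- the XOR lemma on the box, then the numbers
  refine (abs_prodCorr_le hn1 M hM01 hε₁.le C hcoreP).trans ?_
  exact numeric_bound hn1 hε hT (by positivity) hlo hhi (sum_Ico_le hn1 M hM01)

end Summit.QuantumAdvantage.QuantumAdvantage.Theorems.LiouvilleNotPPoly.OneTimePad

end
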